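import Mathlib

/-!
# Crux `CubicForrelation.NearExactIsExact` (stmt-QuantumAdvantage-14043) — E1280-even, R4 branch, descendant `T` (`HL 1`): the BUDGET
  over the ten cells of `Z₁₀`

Certificate seat `b2b-cforr-cert` (gen 43).  HONEST FRAMING: kernel-checked finite bookkeeping (standard axioms) for the descendant
`t̄₇ = T` of …CubicFormR4PartnerDispatch (`HL 1`).  The weight identity of the adapted R4 frame bounds `Σ_{v ∈ Z₁₀} #f_v ≤ 255`
(`Z₁₀ = {v ∈ 𝔽₂⁴ : v₀v₁ = v₂v₃}`, ten explicit points), every cell weighs `≥ 16`, and the various case analyses of the descendant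
produce lower bounds on sub-families of cells indexed by an AFFINE function `α(v) = e ⊕ v₀e₀ ⊕ v₁e₁ ⊕ v₂e₂ ⊕ v₃e₃` with `(e₀,…,e₃) ≠ 0`
(a nonconstant affine function is `1` on `4` or `6` points of `Z₁₀`).  Each lemma here turns such bounds into `False` (or into a
constraint): the combinatorial core is a `decide` over the coefficient bits, the rest is `omega` over the ten weights.
* `tq1_affine_nonconst`: an affine function taking both values has a nonzero linear part.
* `tq1_budget_g40`: cells `≥ 40` where `α = 1` is impossible (`4·40 + 6·16 = 256`).
* `tq1_budget_g64`: cells `≥ 32` where `α = 1` plus one cell of `Z₁₀` at `64` is impossible.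
* `tq1_budget_g5`: if cells are `≥ 32` wherever `α = 1` or `β = 1` (`β` affine), then `β ∈ {0, α}` coefficientwise — returned as
  `β = x·α` for a bit `x` (two affine functions vanishing on the `≥ 5` exact cells).
* `tq1_budget_two64`: two distinct cells of `Z₁₀` at `64` are impossible (`2·64 + 8·16 = 256`).
* `tq1_dep4`: four vectors of `𝔽₂³` are linearly dependent (explicit `decide`).
Nothing about `θ₁₂`; NOT summit progress.

References: this seat lineage (g37 R4-PARTNER §5, g39 HANDPROOFS §2.2–2.3, g43 LEAN-GEN43).  Axioms: the standard three.
-/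

set_option linter.dupNamespace false -- D-0017: single-problem summit ⇒ `QuantumAdvantage.QuantumAdvantage` by design
set_option synthInstance.maxSize 8192
set_option synthInstance.maxHeartbeats 200000

namespace Summit.QuantumAdvantage.QuantumAdvantage.Theorems.CubicForrelation.NearExactIsExact

/-- **An affine function on `𝔽₂⁴` taking both values has a nonzero linear part.** [folklore] -/
theorem tq1_affine_nonconst (e e0 e1 e2 e3 : Bool) (v₁ v₀ : Fin 4 → Bool)
    (h1 : ((((e ^^ (v₁ 0 && e0)) ^^ (v₁ 1 && e1)) ^^ (v₁ 2 && e2)) ^^ (v₁ 3 && e3)) = true) (h0 : ((((e ^^ (v₀ 0 && e0)) ^^ (v₀ 1 && e1)) ^^ (v₀ 2 && e2)) ^^ (v₀ 3 && e3)) = false) : (e0 || e1 || e2 || e3) = true := by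
  revert h1 h0
  cases e0 <;> cases e1 <;> cases e2 <;> cases e3 <;> simp

/-- Core of `tq1_budget_g40`: a nonconstant affine function is `1` on at least four of the ten points of `Z₁₀`, weighted. [this work] -/
theorem tq1_budget_g40_core : ∀ (e e0 e1 e2 e3 : Bool), (e0 || e1 || e2 || e3) = true →
    256 ≤ (if ((((e ^^ (![false, false, false, false] 0 && e0)) ^^ (![false, false, false, false] 1 && e1)) ^^ (![false, false, false, false] 2 && e2)) ^^ (![false, false, false, false] 3 && e3)) = true then 40 else 16) +
      (if ((((e ^^ (![false, false, false, true] 0 && e0)) ^^ (![false, false, false, true] 1 && e1)) ^^ (![false, false, false, true] 2 && e2)) ^^ (![false, false, false, true] 3 && e3)) = true then 40 else 16) +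
      (if ((((e ^^ (![false, false, true, false] 0 && e0)) ^^ (![false, false, true, false] 1 && e1)) ^^ (![false, false, true, false] 2 && e2)) ^^ (![false, false, true, false] 3 && e3)) = true then 40 else 16) +
      (if ((((e ^^ (![false, true, false, false] 0 && e0)) ^^ (![false, true, false, false] 1 && e1)) ^^ (![false, true, false, false] 2 && e2)) ^^ (![false, true, false, false] 3 && e3)) = true then 40 else 16) +
      (if ((((e ^^ (![false, true, false, true] 0 && e0)) ^^ (![false, true, false, true] 1 && e1)) ^^ (![false, true, false, true] 2 && e2)) ^^ (![false, true, false, true] 3 && e3)) = true then 40 else 16) +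
      (if ((((e ^^ (![false, true, true, false] 0 && e0)) ^^ (![false, true, true, false] 1 && e1)) ^^ (![false, true, true, false] 2 && e2)) ^^ (![false, true, true, false] 3 && e3)) = true then 40 else 16) +
      (if ((((e ^^ (![true, false, false, false] 0 && e0)) ^^ (![true, false, false, false] 1 && e1)) ^^ (![true, false, false, false] 2 && e2)) ^^ (![true, false, false, false] 3 && e3)) = true then 40 else 16) +
      (if ((((e ^^ (![true, false, false, true] 0 && e0)) ^^ (![true, false, false, true] 1 && e1)) ^^ (![true, false, false, true] 2 && e2)) ^^ (![true, false, false, true] 3 && e3)) = true then 40 else 16) +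
      (if ((((e ^^ (![true, false, true, false] 0 && e0)) ^^ (![true, false, true, false] 1 && e1)) ^^ (![true, false, true, false] 2 && e2)) ^^ (![true, false, true, false] 3 && e3)) = true then 40 else 16) +
      (if ((((e ^^ (![true, true, true, true] 0 && e0)) ^^ (![true, true, true, true] 1 && e1)) ^^ (![true, true, true, true] 2 && e2)) ^^ (![true, true, true, true] 3 && e3)) = true then 40 else 16) := by
  decide

/-- **Budget `G40`.**  If every cell of `Z₁₀` weighs `≥ 16`, their sum is `≤ 255`, and the cells where a nonconstant affine `α` equals
`1` weigh `≥ 40`, contradiction. [this work] -/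
theorem tq1_budget_g40 (w : (Fin 4 → Bool) → ℕ) (h16 : ∀ v, 16 ≤ w v) (hS : w ![false, false, false, false] + w ![false, false, false, true] + w ![false, false, true, false] + w ![false, true, false, false] + w ![false, true, false, true] + w ![false, true, true, false] + w ![true, false, false, false] + w ![true, false, false, true] + w ![true, false, true, false] + w ![true, true, true, true] ≤ 255)
    (e e0 e1 e2 e3 : Bool) (hA : (e0 || e1 || e2 || e3) = true)
    (h40 : ∀ v : Fin 4 → Bool, ((v 0 && v 1) ^^ (v 2 && v 3)) = false → ((((e ^^ (v 0 && e0)) ^^ (v 1 && e1)) ^^ (v 2 && e2)) ^^ (v 3 && e3)) = true → 40 ≤ w v) : False := by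
  have key : ∀ v : Fin 4 → Bool, ((v 0 && v 1) ^^ (v 2 && v 3)) = false → (if ((((e ^^ (v 0 && e0)) ^^ (v 1 && e1)) ^^ (v 2 && e2)) ^^ (v 3 && e3)) = true then 40 else 16) ≤ w v := by
    intro v hv
    split_ifs with h
    · exact h40 v hv h
    · exact h16 v
  have l0 := key ![false, false, false, false] (by decide)
  have l1 := key ![false, false, false, true] (by decide)
  have l2 := key ![false, false, true, false] (by decide)
  have l3 := key ![false, true, false, false] (by decide)
  have l4 := key ![false, true, false, true] (by decide)
  have l5 := key ![false, true, true, false] (by decide)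
  have l6 := key ![true, false, false, false] (by decide)
  have l7 := key ![true, false, false, true] (by decide)
  have l8 := key ![true, false, true, false] (by decide)
  have l9 := key ![true, true, true, true] (by decide)
  have core := tq1_budget_g40_core e e0 e1 e2 e3 hA
  omega

/-- Core of `tq1_budget_g64`: `Σ_{Z₁₀} (32·[α=1] + 16·[α=0]) ≥ 224` for a nonconstant affine `α`. [this work] -/
theorem tq1_budget_g64_core : ∀ (e e0 e1 e2 e3 : Bool), (e0 || e1 || e2 || e3) = true →
    224 ≤ (if ((((e ^^ (![false, false, false, false] 0 && e0)) ^^ (![false, false, false, false] 1 && e1)) ^^ (![false, false, false, false] 2 && e2)) ^^ (![false, false, false, false] 3 && e3)) = true then 32 else 16) +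
      (if ((((e ^^ (![false, false, false, true] 0 && e0)) ^^ (![false, false, false, true] 1 && e1)) ^^ (![false, false, false, true] 2 && e2)) ^^ (![false, false, false, true] 3 && e3)) = true then 32 else 16) +
      (if ((((e ^^ (![false, false, true, false] 0 && e0)) ^^ (![false, false, true, false] 1 && e1)) ^^ (![false, false, true, false] 2 && e2)) ^^ (![false, false, true, false] 3 && e3)) = true then 32 else 16) +
      (if ((((e ^^ (![false, true, false, false] 0 && e0)) ^^ (![false, true, false, false] 1 && e1)) ^^ (![false, true, false, false] 2 && e2)) ^^ (![false, true, false, false] 3 && e3)) = true then 32 else 16) +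
      (if ((((e ^^ (![false, true, false, true] 0 && e0)) ^^ (![false, true, false, true] 1 && e1)) ^^ (![false, true, false, true] 2 && e2)) ^^ (![false, true, false, true] 3 && e3)) = true then 32 else 16) +
      (if ((((e ^^ (![false, true, true, false] 0 && e0)) ^^ (![false, true, true, false] 1 && e1)) ^^ (![false, true, true, false] 2 && e2)) ^^ (![false, true, true, false] 3 && e3)) = true then 32 else 16) +
      (if ((((e ^^ (![true, false, false, false] 0 && e0)) ^^ (![true, false, false, false] 1 && e1)) ^^ (![true, false, false, false] 2 && e2)) ^^ (![true, false, false, false] 3 && e3)) = true then 32 else 16) +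
      (if ((((e ^^ (![true, false, false, true] 0 && e0)) ^^ (![true, false, false, true] 1 && e1)) ^^ (![true, false, false, true] 2 && e2)) ^^ (![true, false, false, true] 3 && e3)) = true then 32 else 16) +
      (if ((((e ^^ (![true, false, true, false] 0 && e0)) ^^ (![true, false, true, false] 1 && e1)) ^^ (![true, false, true, false] 2 && e2)) ^^ (![true, false, true, false] 3 && e3)) = true then 32 else 16) +
      (if ((((e ^^ (![true, true, true, true] 0 && e0)) ^^ (![true, true, true, true] 1 && e1)) ^^ (![true, true, true, true] 2 && e2)) ^^ (![true, true, true, true] 3 && e3)) = true then 32 else 16) := by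
  decide

/-- **Budget `G64`.**  Cells `≥ 16`, sum over `Z₁₀` `≤ 255`, cells `≥ 32` where the nonconstant affine `α` is `1`, and one cell of
`Z₁₀` weighing `≥ 64`: contradiction (`64 + 3·32 + 6·16 = 256`). [this work] -/
theorem tq1_budget_g64 (w : (Fin 4 → Bool) → ℕ) (h16 : ∀ v, 16 ≤ w v) (hS : w ![false, false, false, false] + w ![false, false, false, true] + w ![false, false, true, false] + w ![false, true, false, false] + w ![false, true, false, true] + w ![false, true, true, false] + w ![true, false, false, false] + w ![true, false, false, true] + w ![true, false, true, false] + w ![true, true, true, true] ≤ 255)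
    (e e0 e1 e2 e3 : Bool) (hA : (e0 || e1 || e2 || e3) = true)
    (h32 : ∀ v : Fin 4 → Bool, ((v 0 && v 1) ^^ (v 2 && v 3)) = false → ((((e ^^ (v 0 && e0)) ^^ (v 1 && e1)) ^^ (v 2 && e2)) ^^ (v 3 && e3)) = true → 32 ≤ w v)
    (p : Fin 4 → Bool) (hp : ((p 0 && p 1) ^^ (p 2 && p 3)) = false) (h64 : 64 ≤ w p) : False := by
  have key : ∀ v : Fin 4 → Bool, ((v 0 && v 1) ^^ (v 2 && v 3)) = false → (if ((((e ^^ (v 0 && e0)) ^^ (v 1 && e1)) ^^ (v 2 && e2)) ^^ (v 3 && e3)) = true then 32 else 16) ≤ w v := by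
    intro v hv
    split_ifs with h
    · exact h32 v hv h
    · exact h16 v
  have l0 := key ![false, false, false, false] (by decide)
  have l1 := key ![false, false, false, true] (by decide)
  have l2 := key ![false, false, true, false] (by decide)
  have l3 := key ![false, true, false, false] (by decide)
  have l4 := key ![false, true, false, true] (by decide)
  have l5 := key ![false, true, true, false] (by decide)
  have l6 := key ![true, false, false, false] (by decide)
  have l7 := key ![true, false, false, true] (by decide)
  have l8 := key ![true, false, true, false] (by decide)
  have l9 := key ![true, true, true, true] (by decide)
  have core := tq1_budget_g64_core e e0 e1 e2 e3 hA
  have b32 : ∀ c : Prop, ∀ _ : Decidable c, (if c then 32 else 16 : ℕ) ≤ 32 := by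
    intro c _; split_ifs <;> omega
  have ep : p = ![p 0, p 1, p 2, p 3] := by funext i; fin_cases i <;> rfl
  rw [ep] at hp h64
  revert hp h64
  generalize p 0 = p0; generalize p 1 = p1; generalize p 2 = p2; generalize p 3 = p3
  intro hp h64
  cases p0 <;> cases p1 <;> cases p2 <;> cases p3 <;>
    first
    | exact absurd hp (by decide)
    | (have bb := b32 (((((e ^^ (![false, false, false, false] 0 && e0)) ^^ (![false, false, false, false] 1 && e1)) ^^ (![false, false, false, false] 2 && e2)) ^^ (![false, false, false, false] 3 && e3)) = true) inferInstance; omega)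
    | (have bb := b32 (((((e ^^ (![false, false, false, true] 0 && e0)) ^^ (![false, false, false, true] 1 && e1)) ^^ (![false, false, false, true] 2 && e2)) ^^ (![false, false, false, true] 3 && e3)) = true) inferInstance; omega)
    | (have bb := b32 (((((e ^^ (![false, false, true, false] 0 && e0)) ^^ (![false, false, true, false] 1 && e1)) ^^ (![false, false, true, false] 2 && e2)) ^^ (![false, false, true, false] 3 && e3)) = true) inferInstance; omega)
    | (have bb := b32 (((((e ^^ (![false, true, false, false] 0 && e0)) ^^ (![false, true, false, false] 1 && e1)) ^^ (![false, true, false, false] 2 && e2)) ^^ (![false, true, false, false] 3 && e3)) = true) inferInstance; omega)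
    | (have bb := b32 (((((e ^^ (![false, true, false, true] 0 && e0)) ^^ (![false, true, false, true] 1 && e1)) ^^ (![false, true, false, true] 2 && e2)) ^^ (![false, true, false, true] 3 && e3)) = true) inferInstance; omega)
    | (have bb := b32 (((((e ^^ (![false, true, true, false] 0 && e0)) ^^ (![false, true, true, false] 1 && e1)) ^^ (![false, true, true, false] 2 && e2)) ^^ (![false, true, true, false] 3 && e3)) = true) inferInstance; omega)
    | (have bb := b32 (((((e ^^ (![true, false, false, false] 0 && e0)) ^^ (![true, false, false, false] 1 && e1)) ^^ (![true, false, false, false] 2 && e2)) ^^ (![true, false, false, false] 3 && e3)) = true) inferInstance; omega)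
    | (have bb := b32 (((((e ^^ (![true, false, false, true] 0 && e0)) ^^ (![true, false, false, true] 1 && e1)) ^^ (![true, false, false, true] 2 && e2)) ^^ (![true, false, false, true] 3 && e3)) = true) inferInstance; omega)
    | (have bb := b32 (((((e ^^ (![true, false, true, false] 0 && e0)) ^^ (![true, false, true, false] 1 && e1)) ^^ (![true, false, true, false] 2 && e2)) ^^ (![true, false, true, false] 3 && e3)) = true) inferInstance; omega)
    | (have bb := b32 (((((e ^^ (![true, true, true, true] 0 && e0)) ^^ (![true, true, true, true] 1 && e1)) ^^ (![true, true, true, true] 2 && e2)) ^^ (![true, true, true, true] 3 && e3)) = true) inferInstance; omega)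

/-- Core of `tq1_budget_g5`: for a nonconstant affine `α` (bits `e`) and an affine `β` (bits `g`) with `β ∉ {0, α}`, the points of
`Z₁₀` where `α = 1` or `β = 1` number at least six, weighted: if the weighted sum is `≤ 255` then `β = x·α` for a bit `x`. [this work] -/
theorem tq1_budget_g5_core : ∀ (e e0 e1 e2 e3 g g0 g1 g2 g3 : Bool), (e0 || e1 || e2 || e3) = true →
    (if (((((e ^^ (![false, false, false, false] 0 && e0)) ^^ (![false, false, false, false] 1 && e1)) ^^ (![false, false, false, false] 2 && e2)) ^^ (![false, false, false, false] 3 && e3)) || ((((g ^^ (![false, false, false, false] 0 && g0)) ^^ (![false, false, false, false] 1 && g1)) ^^ (![false, false, false, false] 2 && g2)) ^^ (![false, false, false, false] 3 && g3))) = true then 32 else 16) +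
      (if (((((e ^^ (![false, false, false, true] 0 && e0)) ^^ (![false, false, false, true] 1 && e1)) ^^ (![false, false, false, true] 2 && e2)) ^^ (![false, false, false, true] 3 && e3)) || ((((g ^^ (![false, false, false, true] 0 && g0)) ^^ (![false, false, false, true] 1 && g1)) ^^ (![false, false, false, true] 2 && g2)) ^^ (![false, false, false, true] 3 && g3))) = true then 32 else 16) +
      (if (((((e ^^ (![false, false, true, false] 0 && e0)) ^^ (![false, false, true, false] 1 && e1)) ^^ (![false, false, true, false] 2 && e2)) ^^ (![false, false, true, false] 3 && e3)) || ((((g ^^ (![false, false, true, false] 0 && g0)) ^^ (![false, false, true, false] 1 && g1)) ^^ (![false, false, true, false] 2 && g2)) ^^ (![false, false, true, false] 3 && g3))) = true then 32 else 16) +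
      (if (((((e ^^ (![false, true, false, false] 0 && e0)) ^^ (![false, true, false, false] 1 && e1)) ^^ (![false, true, false, false] 2 && e2)) ^^ (![false, true, false, false] 3 && e3)) || ((((g ^^ (![false, true, false, false] 0 && g0)) ^^ (![false, true, false, false] 1 && g1)) ^^ (![false, true, false, false] 2 && g2)) ^^ (![false, true, false, false] 3 && g3))) = true then 32 else 16) +
      (if (((((e ^^ (![false, true, false, true] 0 && e0)) ^^ (![false, true, false, true] 1 && e1)) ^^ (![false, true, false, true] 2 && e2)) ^^ (![false, true, false, true] 3 && e3)) || ((((g ^^ (![false, true, false, true] 0 && g0)) ^^ (![false, true, false, true] 1 && g1)) ^^ (![false, true, false, true] 2 && g2)) ^^ (![false, true, false, true] 3 && g3))) = true then 32 else 16) +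
      (if (((((e ^^ (![false, true, true, false] 0 && e0)) ^^ (![false, true, true, false] 1 && e1)) ^^ (![false, true, true, false] 2 && e2)) ^^ (![false, true, true, false] 3 && e3)) || ((((g ^^ (![false, true, true, false] 0 && g0)) ^^ (![false, true, true, false] 1 && g1)) ^^ (![false, true, true, false] 2 && g2)) ^^ (![false, true, true, false] 3 && g3))) = true then 32 else 16) +
      (if (((((e ^^ (![true, false, false, false] 0 && e0)) ^^ (![true, false, false, false] 1 && e1)) ^^ (![true, false, false, false] 2 && e2)) ^^ (![true, false, false, false] 3 && e3)) || ((((g ^^ (![true, false, false, false] 0 && g0)) ^^ (![true, false, false, false] 1 && g1)) ^^ (![true, false, false, false] 2 && g2)) ^^ (![true, false, false, false] 3 && g3))) = true then 32 else 16) +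
      (if (((((e ^^ (![true, false, false, true] 0 && e0)) ^^ (![true, false, false, true] 1 && e1)) ^^ (![true, false, false, true] 2 && e2)) ^^ (![true, false, false, true] 3 && e3)) || ((((g ^^ (![true, false, false, true] 0 && g0)) ^^ (![true, false, false, true] 1 && g1)) ^^ (![true, false, false, true] 2 && g2)) ^^ (![true, false, false, true] 3 && g3))) = true then 32 else 16) +
      (if (((((e ^^ (![true, false, true, false] 0 && e0)) ^^ (![true, false, true, false] 1 && e1)) ^^ (![true, false, true, false] 2 && e2)) ^^ (![true, false, true, false] 3 && e3)) || ((((g ^^ (![true, false, true, false] 0 && g0)) ^^ (![true, false, true, false] 1 && g1)) ^^ (![true, false, true, false] 2 && g2)) ^^ (![true, false, true, false] 3 && g3))) = true then 32 else 16) +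
      (if (((((e ^^ (![true, true, true, true] 0 && e0)) ^^ (![true, true, true, true] 1 && e1)) ^^ (![true, true, true, true] 2 && e2)) ^^ (![true, true, true, true] 3 && e3)) || ((((g ^^ (![true, true, true, true] 0 && g0)) ^^ (![true, true, true, true] 1 && g1)) ^^ (![true, true, true, true] 2 && g2)) ^^ (![true, true, true, true] 3 && g3))) = true then 32 else 16) ≤ 255 →
    ∃ x : Bool, g = (x && e) ∧ g0 = (x && e0) ∧ g1 = (x && e1) ∧ g2 = (x && e2) ∧ g3 = (x && e3) := by
  decide

/-- **Budget `G5`: two affine functions vanishing on the exact cells are proportional.**  Cells `≥ 16`, sum over `Z₁₀` `≤ 255`, cells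
`≥ 32` wherever the nonconstant affine `α` (bits `e`) or the affine `β` (bits `g`) is `1`: then `β = x·α` coefficientwise for a bit `x`.
[this work] -/
theorem tq1_budget_g5 (w : (Fin 4 → Bool) → ℕ) (h16 : ∀ v, 16 ≤ w v) (hS : w ![false, false, false, false] + w ![false, false, false, true] + w ![false, false, true, false] + w ![false, true, false, false] + w ![false, true, false, true] + w ![false, true, true, false] + w ![true, false, false, false] + w ![true, false, false, true] + w ![true, false, true, false] + w ![true, true, true, true] ≤ 255)
    (e e0 e1 e2 e3 : Bool) (hA : (e0 || e1 || e2 || e3) = true) (g g0 g1 g2 g3 : Bool)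
    (h32 : ∀ v : Fin 4 → Bool, ((v 0 && v 1) ^^ (v 2 && v 3)) = false → ((((e ^^ (v 0 && e0)) ^^ (v 1 && e1)) ^^ (v 2 && e2)) ^^ (v 3 && e3)) = true → 32 ≤ w v)
    (h32' : ∀ v : Fin 4 → Bool, ((v 0 && v 1) ^^ (v 2 && v 3)) = false → ((((g ^^ (v 0 && g0)) ^^ (v 1 && g1)) ^^ (v 2 && g2)) ^^ (v 3 && g3)) = true → 32 ≤ w v) :
    ∃ x : Bool, g = (x && e) ∧ g0 = (x && e0) ∧ g1 = (x && e1) ∧ g2 = (x && e2) ∧ g3 = (x && e3) := by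
  have key : ∀ v : Fin 4 → Bool, ((v 0 && v 1) ^^ (v 2 && v 3)) = false → (if (((((e ^^ (v 0 && e0)) ^^ (v 1 && e1)) ^^ (v 2 && e2)) ^^ (v 3 && e3)) || ((((g ^^ (v 0 && g0)) ^^ (v 1 && g1)) ^^ (v 2 && g2)) ^^ (v 3 && g3))) = true then 32 else 16) ≤ w v := by
    intro v hv
    split_ifs with h
    · rcases Bool.or_eq_true_iff.mp h with h | h
      · exact h32 v hv h
      · exact h32' v hv h
    · exact h16 v
  have l0 := key ![false, false, false, false] (by decide)
  have l1 := key ![false, false, false, true] (by decide)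
  have l2 := key ![false, false, true, false] (by decide)
  have l3 := key ![false, true, false, false] (by decide)
  have l4 := key ![false, true, false, true] (by decide)
  have l5 := key ![false, true, true, false] (by decide)
  have l6 := key ![true, false, false, false] (by decide)
  have l7 := key ![true, false, false, true] (by decide)
  have l8 := key ![true, false, true, false] (by decide)
  have l9 := key ![true, true, true, true] (by decide)
  exact tq1_budget_g5_core e e0 e1 e2 e3 g g0 g1 g2 g3 hA (by omega)

/-- **Two distinct cells of `Z₁₀` at `64` are impossible** when every cell weighs `≥ 16` and the sum over `Z₁₀` is `≤ 255`
(`2·64 + 8·16 = 256`). [this work] -/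
theorem tq1_budget_two64 (w : (Fin 4 → Bool) → ℕ) (h16 : ∀ v, 16 ≤ w v) (hS : w ![false, false, false, false] + w ![false, false, false, true] + w ![false, false, true, false] + w ![false, true, false, false] + w ![false, true, false, true] + w ![false, true, true, false] + w ![true, false, false, false] + w ![true, false, false, true] + w ![true, false, true, false] + w ![true, true, true, true] ≤ 255)
    (p v : Fin 4 → Bool) (hp : ((p 0 && p 1) ^^ (p 2 && p 3)) = false) (hv : ((v 0 && v 1) ^^ (v 2 && v 3)) = false) (hpv : p ≠ v)
    (h64p : 64 ≤ w p) (h64v : 64 ≤ w v) : False := by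
  have ep : p = ![p 0, p 1, p 2, p 3] := by funext i; fin_cases i <;> rfl
  have ev : v = ![v 0, v 1, v 2, v 3] := by funext i; fin_cases i <;> rfl
  rw [ep] at h64p hpv; rw [ev] at h64v hpv
  have a0 := h16 ![false, false, false, false]
  have a1 := h16 ![false, false, false, true]
  have a2 := h16 ![false, false, true, false]
  have a3 := h16 ![false, true, false, false]
  have a4 := h16 ![false, true, false, true]
  have a5 := h16 ![false, true, true, false]
  have a6 := h16 ![true, false, false, false]
  have a7 := h16 ![true, false, false, true]
  have a8 := h16 ![true, false, true, false]
  have a9 := h16 ![true, true, true, true]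
  revert hp hv hpv h64p h64v
  generalize p 0 = p0; generalize p 1 = p1; generalize p 2 = p2; generalize p 3 = p3
  generalize v 0 = v0; generalize v 1 = v1; generalize v 2 = v2; generalize v 3 = v3
  intro hp hv hpv h64p h64v
  cases p0 <;> cases p1 <;> cases p2 <;> cases p3 <;> cases v0 <;> cases v1 <;> cases v2 <;> cases v3 <;>
    first | exact absurd hp (by decide) | exact absurd hv (by decide) | exact absurd rfl hpv | omega

/-- **Four vectors of `𝔽₂³` are linearly dependent**: for any `4 × 3` bit matrix `r` there is a nonzero `u ∈ 𝔽₂⁴` with `uᵀ r = 0`.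
[folklore] -/
theorem tq1_dep4 : ∀ (r00 r01 r02 r10 r11 r12 r20 r21 r22 r30 r31 r32 : Bool),
    ∃ u0 u1 u2 u3 : Bool, (u0 || u1 || u2 || u3) = true ∧ (((u0 && r00) ^^ (u1 && r10)) ^^ ((u2 && r20) ^^ (u3 && r30))) = false ∧
      (((u0 && r01) ^^ (u1 && r11)) ^^ ((u2 && r21) ^^ (u3 && r31))) = false ∧ (((u0 && r02) ^^ (u1 && r12)) ^^ ((u2 && r22) ^^ (u3 && r32))) = false := by
  decide

end Summit.QuantumAdvantage.QuantumAdvantage.Theorems.CubicForrelation.NearExactIsExact
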